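import Literature.Probability.Percolation.ConditionalPositiveAssociationProofs
import HarnessLib

/-!
# van den Berg–Häggström–Kahn's Theorem 1.1 with TWO SOURCES — core (sum form, percolation restricted to a vertex set)
# (PAPER-2 track (ii); seat `prim-consts-2`, gen 15)

builds on p205010 (kernel theorem, internal audit signed; external expert review pending).  Support file
(`--supports stmt-CriticalPhenomena-4575`); memo `run/shared/lean/prim/consts/FROM-prim-consts-2-g15-TWO-SOURCE.md`.
The three `def`s are proof-internal bookkeeping for percolation restricted to a vertex set with a source SET (exactly
parallel to the tree's `BHK2006.rC` / `BHK2006.rD` / `BHK2006.blockE` for one source vertex); no sorries; standard axioms.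
The measure-level statements are in the companion file `…ConstsTwoSourceBHK.lean`.

van den Berg–Häggström–Kahn (RSA 29 (2006), Thm. 1.1) prove, for ONE source `s`, increasing events `A, B` of the open
cluster `C_s` and two repelled sets `X, Y`:  `P(A R_X) P(B R_Y) ≤ P(AB R_{X∩Y}) P(R_{X∪Y})`, `R_W = {s ↮ W}` — by
induction on `|V|`, conditioning on the open star of `Z = X ∩ Y` and applying the Ahlswede–Daykin four functions
theorem on the lattice of repelled sets (their Remark 1 replaces `s` by ONE vertex set, by contraction).  Here:

* `Consts.TwoSource.core₂` — **THEOREM (two-source BHK Theorem 1.1, sum form).**  For `S, S', X, Y ⊆ U` and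
  `F, G ≥ 0` increasing functions of edge sets,
  `E[F(C_S) 1{S ↮ X}] · E[G(C_{S'}) 1{S' ↮ Y}] ≤ E[F G(C_{S∪S'}) 1{S∪S' ↮ X∩Y}] · P(S∩S' ↮ X∪Y)`
  (clusters `C_A = ⋃_{a∈A} C_a` and events `{A ↮ W} = {∀ a ∈ A, ∀ x ∈ W, a ↮ x}` computed in `G[U]`): the sources sit
  on their lattice with the orientation OPPOSITE to the repelled sets.  Proof: BHK's induction verbatim with the
  sources carried along (`step_sum_set` = their identity (6) for a source set); base case `X ∩ Y = ∅` = Harris twice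
  plus the monotonicities `F(C_S) ≤ F(C_{S∪S'})`, `{S↮X} ∩ {S'↮Y} ⊆ {S∩S' ↮ X∪Y}`; inductive step = four functions
  theorem with the induction hypothesis at the repelled sets `(X∖Z) ∪ 𝔰_a`, `(Y∖Z) ∪ 𝔰_b` (`𝔰` = open star of `Z`).
Not in print in this form; derived here.
[cite: VandenbergHaggstromKahn2005, Thm. 1.1 (pp. 3–5), identity (6) (p. 4), Remark 1 after Thm. 1.2 (p. 5)]
-/

noncomputable section

namespace Summit.CriticalPhenomena.PercolationContinuityZ3.Theorems

open MeasureTheory Set Literature.Probability.LatticeModels Literature.Probability.Percolation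
open Literature.Probability.Percolation.BHK2006 DecisionTree
open scoped Classical

namespace Consts

namespace TwoSource

variable {V : Type*}

/-! ### Percolation restricted to `U` with a source SET -/

/-- The union cluster `C_S^U = ⋃_{s ∈ S} C_s^U` of a source set for percolation restricted to the vertex set `U`
(BHK's `C_S`, "the set of edges belonging to open paths starting at vertices of `S`", for the induced model on `U`).
[cite: VandenbergHaggstromKahn2005, §2.1 p. 9 (definition of C_S), §1 p. 4 (the induced model on G minus Z)] -/
def rCS (U : Finset V) (S : Set V) (ω : Set (Sym2 V)) : Set (Sym2 V) := ⋃ s ∈ S, rC U s ω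

/-- The event `{S ↮ X} = {∀ s ∈ S, ∀ x ∈ X, s ↮ x}` for percolation restricted to `U`.
[cite: VandenbergHaggstromKahn2005, §1 p. 3 (`X ↮ Y`), §2.1 p. 9 (`{S ↮ T}`)] -/
def rDS (U : Finset V) (S : Set V) (X : Set V) : Set (Set (Sym2 V)) :=
  {ω | ∀ s ∈ S, ∀ x ∈ X, ¬ (openGraph (ω ∩ edgesIn U)).Reachable s x}

/-- The union cluster is increasing in the configuration. [cite: VandenbergHaggstromKahn2005, §1 p. 3] -/
theorem rCS_mono (U : Finset V) (S : Set V) : Monotone (rCS U S) := by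
  intro a b hab e he
  simp only [rCS, mem_iUnion] at he ⊢
  obtain ⟨s, hs, he⟩ := he
  exact ⟨s, hs, rC_mono U s hab he⟩

/-- The union cluster is increasing in the source set. [folklore] -/
theorem rCS_mono_source (U : Finset V) {S S' : Set V} (h : S ⊆ S') (ω : Set (Sym2 V)) :
    rCS U S ω ⊆ rCS U S' ω := by
  intro e he
  simp only [rCS, mem_iUnion] at he ⊢
  obtain ⟨s, hs, he⟩ := he
  exact ⟨s, h hs, he⟩

/-- `{S ↮ X}` is a decreasing event. [cite: VandenbergHaggstromKahn2005, §1 p. 3] -/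
theorem rDS_decreasing {U : Finset V} {S X : Set V} {ω ω' : Set (Sym2 V)} (h : ω ⊆ ω')
    (h' : ω' ∈ rDS U S X) : ω ∈ rDS U S X := fun s hs => rD_decreasing h (h' s hs)

/-- The indicator of `{S ↮ X}` is antitone. [cite: VandenbergHaggstromKahn2005, §1 p. 3] -/
theorem ind_rDS_antitone (U : Finset V) (S X : Set V) : Antitone (ind (rDS U S X)) := by
  intro ω ω' h
  by_cases h' : ω' ∈ rDS U S X
  · rw [ind_of_mem h', ind_of_mem (rDS_decreasing h h')]
  · rw [ind_of_not_mem h']; exact ind_nonneg _ _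

/-- `{S ↮ X}` is antitone in `X`. [folklore] -/
theorem rDS_antitone {U : Finset V} {S X X' : Set V} (h : X ⊆ X') : rDS U S X' ⊆ rDS U S X :=
  fun _ hω s hs x hx => hω s hs x (h hx)

/-- `{S ↮ X} = ∅` if a source lies in `X`. [folklore] -/
theorem rDS_eq_empty {U : Finset V} {S X : Set V} {s : V} (hs : s ∈ S) (hx : s ∈ X) :
    rDS U S X = ∅ :=
  Set.eq_empty_of_forall_notMem fun _ hω => hω s hs s hx (SimpleGraph.Reachable.refl s)

/-- **The source/target bookkeeping of the base case**: `{S ↮ X} ∩ {S' ↮ Y} ⊆ {S ∩ S' ↮ X ∪ Y}`. [folklore] -/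
theorem rDS_inter_subset (U : Finset V) (S S' X Y : Set V) :
    rDS U S X ∩ rDS U S' Y ⊆ rDS U (S ∩ S') (X ∪ Y) := by
  rintro ω ⟨h1, h2⟩ s ⟨hs, hs'⟩ x (hx | hx)
  · exact h1 s hs x hx
  · exact h2 s hs' x hx

/-- The union cluster in `G[U ∖ Z]` does not depend on the edges meeting `Z`. [folklore] -/
theorem rCS_diff_meeting (U Z : Finset V) (S : Set V) (ω : Set (Sym2 V)) :
    rCS (U \ Z) S (ω \ meeting Z) = rCS (U \ Z) S ω := by
  simp only [rCS, rC_diff_meeting]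

/-- The events `{S ↮ T}` of `G[U ∖ Z]` do not depend on the edges meeting `Z`. [folklore] -/
theorem mem_rDS_diff_meeting (U Z : Finset V) (S T : Set V) (ω : Set (Sym2 V)) :
    ω \ meeting Z ∈ rDS (U \ Z) S T ↔ ω ∈ rDS (U \ Z) S T := by
  simp only [rDS, mem_setOf_eq, diff_meeting_inter_edgesIn]

/-- **BHK's identity (6) for a source set**: for `W ⊇ Z` and `S ∩ Z = ∅`, `{S ↮ W in G[U]}` is
`{S ↮ (W ∖ Z) ∪ 𝔰(ω) in G[U ∖ Z]}`. [cite: VandenbergHaggstromKahn2005, §1 p. 4, identity (6)] -/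
theorem mem_rDS_iff_restrict {U Z : Finset V} (hZU : Z ⊆ U) {S : Set V} (hS : ∀ s ∈ S, s ∉ Z)
    {W : Set V} (hZW : (↑Z : Set V) ⊆ W) (ω : Set (Sym2 V)) :
    ω ∈ rDS U S W ↔ ω ∈ rDS (U \ Z) S ((W \ ↑Z) ∪ rS U Z ω) := by
  constructor
  · intro h s hs
    exact (mem_rD_iff_restrict hZU (hS s hs) hZW ω).1 (h s hs)
  · intro h s hs
    exact (mem_rD_iff_restrict hZU (hS s hs) hZW ω).2 (h s hs)

/-- On the event of `mem_rDS_iff_restrict`, the union cluster in `G[U]` is the union cluster in `G[U ∖ Z]`.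
[cite: VandenbergHaggstromKahn2005, §1 p. 4, identity (6) and the remark following it] -/
theorem rCS_restrict {U Z : Finset V} {S : Set V} (hS : ∀ s ∈ S, s ∉ Z) {ω : Set (Sym2 V)}
    (h : ∀ s ∈ S, ∀ n ∈ rS U Z ω, ¬ (openGraph (ω ∩ edgesIn (U \ Z))).Reachable s n) :
    rCS U S ω = rCS (U \ Z) S ω := by
  ext e
  simp only [rCS, mem_iUnion]
  constructor
  · rintro ⟨s, hs, he⟩
    exact ⟨s, hs, by rw [← rC_restrict (hS s hs) (h s hs)]; exact he⟩
  · rintro ⟨s, hs, he⟩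
    exact ⟨s, hs, by rw [rC_restrict (hS s hs) (h s hs)]; exact he⟩

/-! ### Conditioning on the open star (BHK's (6), summed) -/

variable [Fintype V]

/-- The block expectation `T ↦ E[H(C_S^{U'}) · 1{S ↮ B ∪ T in G[U']}]` for a source set.
[cite: VandenbergHaggstromKahn2005, §1 p. 4 (`Pr(· | S)`)] -/
def blockES (w : Sym2 V → ℝ) (U' : Finset V) (S : Set V) (H : Set (Sym2 V) → ℝ) (B T : Set V) : ℝ :=
  ∑ ω, weight w ω * (H (rCS U' S ω) * ind (rDS U' S (B ∪ T)) ω)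

/-- Block expectations of nonnegative functions are nonnegative. [folklore] -/
theorem blockES_nonneg {w : Sym2 V → ℝ} (hw0 : ∀ e, 0 ≤ w e) (hw1 : ∀ e, w e ≤ 1)
    (U' : Finset V) (S : Set V) {H : Set (Sym2 V) → ℝ} (hH : ∀ a, 0 ≤ H a) (B T : Set V) :
    0 ≤ blockES w U' S H B T :=
  sum_ind_nonneg hw0 hw1 (fun _ => hH _) _

/-- **BHK's (6) for a source set**: for `S ∩ Z = ∅` and `Z ⊆ W`,
`E[H(C_S^U) 1{S ↮ W in G[U]}] = Σ_ω weight(ω) · E'[H(C_S^{U∖Z}) 1{S ↮ (W∖Z) ∪ 𝔰(ω)}]`.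
[cite: VandenbergHaggstromKahn2005, §1 p. 4, the display before (5) and identity (6)] -/
theorem step_sum_set {U Z : Finset V} (hZU : Z ⊆ U) {S : Set V} (hS : ∀ s ∈ S, s ∉ Z) {W : Set V}
    (hZW : (↑Z : Set V) ⊆ W) (w : Sym2 V → ℝ) (hm : ∑ ω, weight w ω = 1)
    (H : Set (Sym2 V) → ℝ) :
    ∑ ω, weight w ω * (H (rCS U S ω) * ind (rDS U S W) ω) =
      ∑ ω, weight w ω * blockES w (U \ Z) S H (W \ ↑Z) (rS U Z ω) := by
  set A := meeting Z with hA
  set Φ : Set (Sym2 V) → Set (Sym2 V) → ℝ := fun ζ η =>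
    H (rCS (U \ Z) S η) * ind (rDS (U \ Z) S ((W \ ↑Z) ∪ rS U Z ζ)) η with hΦ
  have h1 : ∀ ω, H (rCS U S ω) * ind (rDS U S W) ω = Φ (ω ∩ A) (ω \ A) := by
    intro ω
    simp only [hΦ, hA, rS_inter_meeting, rCS_diff_meeting]
    by_cases hω : ω ∈ rDS U S W
    · have hω' := (mem_rDS_iff_restrict hZU hS hZW ω).1 hω
      rw [ind_of_mem hω, ind_of_mem ((mem_rDS_diff_meeting U Z S _ ω).2 hω'),
        rCS_restrict hS fun s hs n hn => hω' s hs n (Or.inr hn)]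
    · have hω' : ω \ meeting Z ∉ rDS (U \ Z) S ((W \ ↑Z) ∪ rS U Z ω) := fun h =>
        hω ((mem_rDS_iff_restrict hZU hS hZW ω).2 ((mem_rDS_diff_meeting U Z S _ ω).1 h))
      rw [ind_of_not_mem hω, ind_of_not_mem hω', mul_zero, mul_zero]
  have h2 : ∀ ω ω', Φ (ω ∩ A) (ω' \ A) =
      H (rCS (U \ Z) S ω') * ind (rDS (U \ Z) S ((W \ ↑Z) ∪ rS U Z ω)) ω' := by
    intro ω ω'
    simp only [hΦ, hA, rS_inter_meeting, rCS_diff_meeting]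
    by_cases hω' : ω' ∈ rDS (U \ Z) S ((W \ ↑Z) ∪ rS U Z ω)
    · rw [ind_of_mem hω', ind_of_mem ((mem_rDS_diff_meeting U Z S _ ω').2 hω')]
    · rw [ind_of_not_mem hω', ind_of_not_mem (fun h => hω' ((mem_rDS_diff_meeting U Z S _ ω').1 h))]
  calc ∑ ω, weight w ω * (H (rCS U S ω) * ind (rDS U S W) ω)
      = (∑ ω, weight w ω) * ∑ ω, weight w ω * Φ (ω ∩ A) (ω \ A) := by
        rw [hm, one_mul]; simp_rw [h1]
    _ = ∑ ω, weight w ω * ∑ ω', weight w ω' * Φ (ω ∩ A) (ω' \ A) := blockFubini w A Φ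
    _ = ∑ ω, weight w ω * blockES w (U \ Z) S H (W \ ↑Z) (rS U Z ω) := by
        simp_rw [h2]; rfl

/-! ### The two-source Theorem 1.1 by induction on the vertex set -/

/-- **Two-source BHK Theorem 1.1, functional form, percolation restricted to `U`.**  For
`S, S', X, Y ⊆ U` and `F, G ≥ 0` increasing,
`E[F(C_S) 1{S↮X}] · E[G(C_{S'}) 1{S'↮Y}] ≤ E[F G(C_{S∪S'}) 1{S∪S' ↮ X∩Y}] · P(S∩S' ↮ X∪Y)`.
Proof by strong induction on `U` following BHK pp. 3–5, the sources carried along.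
[cite: VandenbergHaggstromKahn2005, Thm. 1.1 (pp. 3–5) — the one-source case; two sources derived here] -/
theorem core₂ (w : Sym2 V → ℝ) (hw0 : ∀ e, 0 ≤ w e) (hw1 : ∀ e, w e ≤ 1)
    (hm : ∑ ω, weight w ω = 1) (U : Finset V) :
    ∀ (S S' : Set V), S ⊆ ↑U → S' ⊆ ↑U → ∀ (X Y : Set V), X ⊆ ↑U → Y ⊆ ↑U →
    ∀ (F G : Set (Sym2 V) → ℝ), Monotone F → Monotone G → (∀ a, 0 ≤ F a) → (∀ a, 0 ≤ G a) →
    (∑ ω, weight w ω * (F (rCS U S ω) * ind (rDS U S X) ω)) *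
      (∑ ω, weight w ω * (G (rCS U S' ω) * ind (rDS U S' Y) ω)) ≤
    (∑ ω, weight w ω * (F (rCS U (S ∪ S') ω) * G (rCS U (S ∪ S') ω) *
        ind (rDS U (S ∪ S') (X ∩ Y)) ω)) *
      (∑ ω, weight w ω * ind (rDS U (S ∩ S') (X ∪ Y)) ω) := by
  induction U using Finset.strongInduction with
  | H U ih =>
  intro S S' hSU hS'U X Y hXU hYU F G hF hG hF0 hG0
  -- nonnegativity of the right-hand side
  have hRHS : 0 ≤ (∑ ω, weight w ω * (F (rCS U (S ∪ S') ω) * G (rCS U (S ∪ S') ω) *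
      ind (rDS U (S ∪ S') (X ∩ Y)) ω)) * (∑ ω, weight w ω * ind (rDS U (S ∩ S') (X ∪ Y)) ω) :=
    mul_nonneg (Finset.sum_nonneg fun ω _ => mul_nonneg (weight_nonneg hw0 hw1 ω)
      (mul_nonneg (mul_nonneg (hF0 _) (hG0 _)) (ind_nonneg _ _)))
      (Finset.sum_nonneg fun ω _ => mul_nonneg (weight_nonneg hw0 hw1 ω) (ind_nonneg _ _))
  -- trivial cases: a source of `S` in `X`, or a source of `S'` in `Y`
  by_cases hSX : ∃ s ∈ S, s ∈ X
  · obtain ⟨s, hs, hsX⟩ := hSX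
    have h0 : ∑ ω, weight w ω * (F (rCS U S ω) * ind (rDS U S X) ω) = 0 :=
      Finset.sum_eq_zero fun ω _ => by
        rw [rDS_eq_empty hs hsX, ind_of_not_mem (Set.notMem_empty ω)]; ring
    rw [h0, zero_mul]; exact hRHS
  by_cases hSY : ∃ s ∈ S', s ∈ Y
  · obtain ⟨s, hs, hsY⟩ := hSY
    have h0 : ∑ ω, weight w ω * (G (rCS U S' ω) * ind (rDS U S' Y) ω) = 0 :=
      Finset.sum_eq_zero fun ω _ => by
        rw [rDS_eq_empty hs hsY, ind_of_not_mem (Set.notMem_empty ω)]; ring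
    rw [h0, mul_zero]; exact hRHS
  push Not at hSX hSY
  -- `Z := X ∩ Y`
  set Z : Finset V := U.filter fun v => v ∈ X ∧ v ∈ Y with hZ
  have hZU : Z ⊆ U := Finset.filter_subset _ _
  have hmemZ : ∀ v, v ∈ Z ↔ v ∈ X ∧ v ∈ Y := fun v => by
    simp only [hZ, Finset.mem_filter, and_iff_right_iff_imp]
    exact fun h => hXU h.1
  have hSZ : ∀ s ∈ S, s ∉ Z := fun s hs h => hSX s hs ((hmemZ s).1 h).1
  have hS'Z : ∀ s ∈ S', s ∉ Z := fun s hs h => hSY s hs ((hmemZ s).1 h).2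
  have hSS'Z : ∀ s ∈ S ∪ S', s ∉ Z := fun s hs => hs.elim (hSZ s) (hS'Z s)
  have hSiZ : ∀ s ∈ S ∩ S', s ∉ Z := fun s hs => hSZ s hs.1
  rcases Z.eq_empty_or_nonempty with hZe | hZne
  · /- `X ∩ Y = ∅`: two applications of Harris plus the two source monotonicities. -/
    have hXY : ∀ ω, ind (rDS U (S ∪ S') (X ∩ Y)) ω = 1 := fun ω =>
      ind_of_mem fun s _ x hx _ => by
        have : x ∈ Z := (hmemZ x).2 hx
        rw [hZe] at this
        exact absurd this (Finset.notMem_empty x)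
    simp_rw [hXY, mul_one]
    have hFm : Monotone fun ω => F (rCS U S ω) := fun a b hab => hF (rCS_mono U S hab)
    have hGm : Monotone fun ω => G (rCS U S' ω) := fun a b hab => hG (rCS_mono U S' hab)
    have h1 : ∑ ω, weight w ω * (F (rCS U S ω) * ind (rDS U S X) ω) ≤
        (∑ ω, weight w ω * F (rCS U S ω)) * ∑ ω, weight w ω * ind (rDS U S X) ω :=
      harris_mono_anti hw0 hw1 hm (fun _ => hF0 _) hFm
        (ind_rDS_antitone U S X) (fun _ => ind_le_one _ _)
    have h2 : ∑ ω, weight w ω * (G (rCS U S' ω) * ind (rDS U S' Y) ω) ≤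
        (∑ ω, weight w ω * G (rCS U S' ω)) * ∑ ω, weight w ω * ind (rDS U S' Y) ω :=
      harris_mono_anti hw0 hw1 hm (fun _ => hG0 _) hGm
        (ind_rDS_antitone U S' Y) (fun _ => ind_le_one _ _)
    have h3 : (∑ ω, weight w ω * F (rCS U S ω)) * (∑ ω, weight w ω * G (rCS U S' ω)) ≤
        ∑ ω, weight w ω * (F (rCS U S ω) * G (rCS U S' ω)) := by
      have := harris hw0 hw1 (fun _ => hF0 _) (fun _ => hG0 _) hFm hGm
      rwa [hm, one_mul] at this
    have h4 : (∑ ω, weight w ω * ind (rDS U S X) ω) * (∑ ω, weight w ω * ind (rDS U S' Y) ω) ≤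
        ∑ ω, weight w ω * (ind (rDS U S X) ω * ind (rDS U S' Y) ω) :=
      harris_anti_anti hw0 hw1 hm
        (ind_rDS_antitone U S X) (ind_rDS_antitone U S' Y) (fun _ => ind_le_one _ _)
        (fun _ => ind_le_one _ _)
    -- the two source monotonicities
    have h5 : ∑ ω, weight w ω * (F (rCS U S ω) * G (rCS U S' ω)) ≤
        ∑ ω, weight w ω * (F (rCS U (S ∪ S') ω) * G (rCS U (S ∪ S') ω)) :=
      Finset.sum_le_sum fun ω _ => mul_le_mul_of_nonneg_left
        (mul_le_mul (hF (rCS_mono_source U subset_union_left ω))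
          (hG (rCS_mono_source U subset_union_right ω)) (hG0 _) (hF0 _))
        (weight_nonneg hw0 hw1 ω)
    have h6 : ∑ ω, weight w ω * (ind (rDS U S X) ω * ind (rDS U S' Y) ω) ≤
        ∑ ω, weight w ω * ind (rDS U (S ∩ S') (X ∪ Y)) ω := by
      refine Finset.sum_le_sum fun ω _ => mul_le_mul_of_nonneg_left ?_ (weight_nonneg hw0 hw1 ω)
      rw [← ind_inter]
      exact ind_mono (rDS_inter_subset U S S' X Y) ω
    have hFn : 0 ≤ ∑ ω, weight w ω * F (rCS U S ω) :=
      Finset.sum_nonneg fun ω _ => mul_nonneg (weight_nonneg hw0 hw1 ω) (hF0 _)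
    have hGn : 0 ≤ ∑ ω, weight w ω * G (rCS U S' ω) :=
      Finset.sum_nonneg fun ω _ => mul_nonneg (weight_nonneg hw0 hw1 ω) (hG0 _)
    have hXn : 0 ≤ ∑ ω, weight w ω * ind (rDS U S X) ω :=
      Finset.sum_nonneg fun ω _ => mul_nonneg (weight_nonneg hw0 hw1 ω) (ind_nonneg _ _)
    have hYn : 0 ≤ ∑ ω, weight w ω * ind (rDS U S' Y) ω :=
      Finset.sum_nonneg fun ω _ => mul_nonneg (weight_nonneg hw0 hw1 ω) (ind_nonneg _ _)
    have hFGn : 0 ≤ ∑ ω, weight w ω * (F (rCS U (S ∪ S') ω) * G (rCS U (S ∪ S') ω)) :=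
      Finset.sum_nonneg fun ω _ => mul_nonneg (weight_nonneg hw0 hw1 ω)
        (mul_nonneg (hF0 _) (hG0 _))
    calc (∑ ω, weight w ω * (F (rCS U S ω) * ind (rDS U S X) ω)) *
          (∑ ω, weight w ω * (G (rCS U S' ω) * ind (rDS U S' Y) ω))
        ≤ ((∑ ω, weight w ω * F (rCS U S ω)) * ∑ ω, weight w ω * ind (rDS U S X) ω) *
          ((∑ ω, weight w ω * G (rCS U S' ω)) * ∑ ω, weight w ω * ind (rDS U S' Y) ω) :=
          mul_le_mul h1 h2 (sum_ind_nonneg hw0 hw1 (fun _ => hG0 _) _) (mul_nonneg hFn hXn)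
      _ = ((∑ ω, weight w ω * F (rCS U S ω)) * ∑ ω, weight w ω * G (rCS U S' ω)) *
          ((∑ ω, weight w ω * ind (rDS U S X) ω) * ∑ ω, weight w ω * ind (rDS U S' Y) ω) := by
          ring
      _ ≤ (∑ ω, weight w ω * (F (rCS U S ω) * G (rCS U S' ω))) *
          ∑ ω, weight w ω * (ind (rDS U S X) ω * ind (rDS U S' Y) ω) :=
          mul_le_mul h3 h4 (mul_nonneg hXn hYn)
            (Finset.sum_nonneg fun ω _ => mul_nonneg (weight_nonneg hw0 hw1 ω)
              (mul_nonneg (hF0 _) (hG0 _)))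
      _ ≤ (∑ ω, weight w ω * (F (rCS U (S ∪ S') ω) * G (rCS U (S ∪ S') ω))) *
          ∑ ω, weight w ω * ind (rDS U (S ∩ S') (X ∪ Y)) ω :=
          mul_le_mul h5 h6 (Finset.sum_nonneg fun ω _ => mul_nonneg (weight_nonneg hw0 hw1 ω)
            (mul_nonneg (ind_nonneg _ _) (ind_nonneg _ _))) hFGn
  · /- `Z ≠ ∅`: condition on the open star of `Z` and apply the four functions theorem with the
    induction hypothesis on `U ∖ Z` (BHK pp. 4–5), the sources unchanged. -/
    have hss : U \ Z ⊂ U := Finset.sdiff_ssubset hZU hZne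
    have hSU' : S ⊆ ↑(U \ Z) := fun s hs => by
      rw [Finset.coe_sdiff]; exact ⟨hSU hs, fun h => hSZ s hs h⟩
    have hS'U' : S' ⊆ ↑(U \ Z) := fun s hs => by
      rw [Finset.coe_sdiff]; exact ⟨hS'U hs, fun h => hS'Z s hs h⟩
    have hZX : (↑Z : Set V) ⊆ X := fun v hv => ((hmemZ v).1 hv).1
    have hZY : (↑Z : Set V) ⊆ Y := fun v hv => ((hmemZ v).1 hv).2
    have hZXY : (↑Z : Set V) ⊆ X ∩ Y := fun v hv => (hmemZ v).1 hv
    have hZXuY : (↑Z : Set V) ⊆ X ∪ Y := fun v hv => Or.inl (((hmemZ v).1 hv).1)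
    have hFG : Monotone fun a => F a * G a := fun a b hab =>
      mul_le_mul (hF hab) (hG hab) (hG0 _) (hF0 _)
    -- the four sums, conditioned on the star
    have e1 := step_sum_set hZU hSZ hZX w hm F
    have e2 := step_sum_set hZU hS'Z hZY w hm G
    have e3 : ∑ ω, weight w ω * (F (rCS U (S ∪ S') ω) * G (rCS U (S ∪ S') ω) *
        ind (rDS U (S ∪ S') (X ∩ Y)) ω) =
        ∑ ω, weight w ω * blockES w (U \ Z) (S ∪ S') (fun a => F a * G a) ((X ∩ Y) \ ↑Z) (rS U Z ω) :=
      step_sum_set hZU hSS'Z hZXY w hm (fun a => F a * G a)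
    have e4 : ∑ ω, weight w ω * ind (rDS U (S ∩ S') (X ∪ Y)) ω =
        ∑ ω, weight w ω * blockES w (U \ Z) (S ∩ S') (fun _ => 1) ((X ∪ Y) \ ↑Z) (rS U Z ω) := by
      have := step_sum_set hZU hSiZ hZXuY w hm (fun _ => 1)
      simpa only [one_mul] using this
    rw [e1, e2, e3, e4]
    refine four_functions_theorem_univ
      (fun ω => weight w ω * blockES w (U \ Z) S F (X \ ↑Z) (rS U Z ω))
      (fun ω => weight w ω * blockES w (U \ Z) S' G (Y \ ↑Z) (rS U Z ω))
      (fun ω => weight w ω * blockES w (U \ Z) (S ∪ S') (fun a => F a * G a) ((X ∩ Y) \ ↑Z) (rS U Z ω))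
      (fun ω => weight w ω * blockES w (U \ Z) (S ∩ S') (fun _ => 1) ((X ∪ Y) \ ↑Z) (rS U Z ω))
      (fun ω => mul_nonneg (weight_nonneg hw0 hw1 ω) (blockES_nonneg hw0 hw1 _ _ hF0 _ _))
      (fun ω => mul_nonneg (weight_nonneg hw0 hw1 ω) (blockES_nonneg hw0 hw1 _ _ hG0 _ _))
      (fun ω => mul_nonneg (weight_nonneg hw0 hw1 ω)
        (blockES_nonneg hw0 hw1 _ _ (fun a => mul_nonneg (hF0 a) (hG0 a)) _ _))
      (fun ω => mul_nonneg (weight_nonneg hw0 hw1 ω)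
        (blockES_nonneg hw0 hw1 _ _ (fun _ => zero_le_one) _ _))
      fun a b => ?_
    -- the Ahlswede–Daykin hypothesis: weight lattice identity × induction hypothesis
    set Sa := rS U Z a with hSa
    set Sb := rS U Z b with hSb
    have hSaU : Sa ⊆ ↑(U \ Z) := rS_subset U Z a
    have hSbU : Sb ⊆ ↑(U \ Z) := rS_subset U Z b
    have hX1 : X \ ↑Z ∪ Sa ⊆ ↑(U \ Z) := Set.union_subset
      (fun v hv => by rw [Finset.coe_sdiff]; exact ⟨hXU hv.1, hv.2⟩) hSaU
    have hY1 : Y \ ↑Z ∪ Sb ⊆ ↑(U \ Z) := Set.union_subset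
      (fun v hv => by rw [Finset.coe_sdiff]; exact ⟨hYU hv.1, hv.2⟩) hSbU
    have IH := ih (U \ Z) hss S S' hSU' hS'U' (X \ ↑Z ∪ Sa) (Y \ ↑Z ∪ Sb) hX1 hY1 F G hF hG hF0 hG0
    -- monotonicity in the conditioning sets
    have hsub3 : (X ∩ Y) \ ↑Z ∪ rS U Z (a ∩ b) ⊆ (X \ ↑Z ∪ Sa) ∩ (Y \ ↑Z ∪ Sb) := by
      refine Set.union_subset (fun v hv => ⟨Or.inl ⟨hv.1.1, hv.2⟩, Or.inl ⟨hv.1.2, hv.2⟩⟩) ?_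
      exact fun v hv =>
        ⟨Or.inr (rS_inter_subset U Z a b hv).1, Or.inr (rS_inter_subset U Z a b hv).2⟩
    have hsub4 : (X ∪ Y) \ ↑Z ∪ rS U Z (a ∪ b) ⊆ (X \ ↑Z ∪ Sa) ∪ (Y \ ↑Z ∪ Sb) := by
      rw [rS_union]
      rintro v (⟨hXY | hXY, hvZ⟩ | hS | hS)
      · exact Or.inl (Or.inl ⟨hXY, hvZ⟩)
      · exact Or.inr (Or.inl ⟨hXY, hvZ⟩)
      · exact Or.inl (Or.inr hS)
      · exact Or.inr (Or.inr hS)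
    have h3 : ∑ ω, weight w ω * (F (rCS (U \ Z) (S ∪ S') ω) * G (rCS (U \ Z) (S ∪ S') ω) *
        ind (rDS (U \ Z) (S ∪ S') ((X \ ↑Z ∪ Sa) ∩ (Y \ ↑Z ∪ Sb))) ω) ≤
        blockES w (U \ Z) (S ∪ S') (fun a => F a * G a) ((X ∩ Y) \ ↑Z) (rS U Z (a ∩ b)) :=
      sum_ind_mono hw0 hw1 (fun ω => mul_nonneg (hF0 _) (hG0 _)) (rDS_antitone hsub3)
    have h4 : ∑ ω, weight w ω * ind (rDS (U \ Z) (S ∩ S') ((X \ ↑Z ∪ Sa) ∪ (Y \ ↑Z ∪ Sb))) ω ≤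
        blockES w (U \ Z) (S ∩ S') (fun _ => 1) ((X ∪ Y) \ ↑Z) (rS U Z (a ∪ b)) := by
      have := sum_ind_mono hw0 hw1 (h := fun _ => (1 : ℝ)) (fun _ => zero_le_one)
        (rDS_antitone (U := U \ Z) (S := S ∩ S') hsub4) (w := w)
      simp only [one_mul] at this
      simpa only [blockES, one_mul] using this
    have hIH' : blockES w (U \ Z) S F (X \ ↑Z) Sa * blockES w (U \ Z) S' G (Y \ ↑Z) Sb ≤
        blockES w (U \ Z) (S ∪ S') (fun a => F a * G a) ((X ∩ Y) \ ↑Z) (rS U Z (a ∩ b)) *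
          blockES w (U \ Z) (S ∩ S') (fun _ => 1) ((X ∪ Y) \ ↑Z) (rS U Z (a ∪ b)) :=
      IH.trans (mul_le_mul h3 h4 (Finset.sum_nonneg fun ω _ =>
        mul_nonneg (weight_nonneg hw0 hw1 ω) (ind_nonneg _ _))
        (blockES_nonneg hw0 hw1 _ _ (fun a => mul_nonneg (hF0 a) (hG0 a)) _ _))
    have hwab := weight_inter_mul_union w a b
    show weight w a * blockES w (U \ Z) S F (X \ ↑Z) Sa *
        (weight w b * blockES w (U \ Z) S' G (Y \ ↑Z) Sb) ≤
      weight w (a ∩ b) * blockES w (U \ Z) (S ∪ S') (fun a => F a * G a) ((X ∩ Y) \ ↑Z) (rS U Z (a ∩ b)) *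
        (weight w (a ∪ b) * blockES w (U \ Z) (S ∩ S') (fun _ => 1) ((X ∪ Y) \ ↑Z) (rS U Z (a ∪ b)))
    calc weight w a * blockES w (U \ Z) S F (X \ ↑Z) Sa *
          (weight w b * blockES w (U \ Z) S' G (Y \ ↑Z) Sb)
        = (weight w a * weight w b) *
          (blockES w (U \ Z) S F (X \ ↑Z) Sa * blockES w (U \ Z) S' G (Y \ ↑Z) Sb) := by ring
      _ ≤ (weight w (a ∩ b) * weight w (a ∪ b)) *
          (blockES w (U \ Z) (S ∪ S') (fun a => F a * G a) ((X ∩ Y) \ ↑Z) (rS U Z (a ∩ b)) *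
            blockES w (U \ Z) (S ∩ S') (fun _ => 1) ((X ∪ Y) \ ↑Z) (rS U Z (a ∪ b))) := by
          rw [hwab]
          exact mul_le_mul_of_nonneg_left hIH'
            (mul_nonneg (weight_nonneg hw0 hw1 _) (weight_nonneg hw0 hw1 _))
      _ = _ := by ring

end TwoSource

end Consts

end Summit.CriticalPhenomena.PercolationContinuityZ3.Theorems

end
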